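import Literature.NumberTheory.Automorphic.PicardUnitaryDatumWitness
import Literature.NumberTheory.Automorphic.PicardCMCompactUnitaryQuotient
import Literature.AlgebraicGeometry.ShimuraVarieties.PrincipalCongruenceSubgroupTorsionFree
import Mathlib.RingTheory.RootsOfUnity.Complex
import Mathlib.Analysis.SpecialFunctions.Trigonometric.Basic
import HarnessLib

/-!
# An explicit sextic Picard datum: `E₇ = ℚ(ζ₇) ⊂ ℂ`, `H₇ = diag(1, 1, -(ζ₇ + ζ₇⁻¹))`, `Γ₇ = Γ(3)`

The arithmetic input of a compact Picard modular surface in the **sextic** regime, as explicit,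
choice-free data in the exact types of the algebraic fields of the tree's
`UnitaryBallQuotientDatum 2 X` / of the binders of `PicardCM.BallQuotientAlgebraic`:

* `E₇ : Subfield ℂ` — the seventh cyclotomic field `ℚ(ζ₇)`, `ζ₇ = exp(2πi/7)`, embedded in `ℂ` by
  the inclusion (the distinguished place `τ₁ = E₇.subtype`); it is a CM number field of degree
  `[E₇ : ℚ] = 6` (`numberField_E₇`, `isCMField_E₇`, `finrank_E₇` — Mathlib's cyclotomic theory);
* `H₇ = diag(1, 1, -c)` with `c = ζ₇ + ζ₇⁻¹ = 2cos(2π/7) ∈ E₇⁺` (`H₇`, `cSeven`): hermitian for the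
  CM conjugation (`H₇_hermitian`); of signature `(2,1)` at the inclusion, because `2cos(2π/7) > 0`
  (`H₇_signature`: `Tᴴ · ι(H₇) · T = diag(1,1,-1)` with `T = diag(1, 1, 1/√(2cos(2π/7)))`); and
  **positive definite at every other complex place** (`posDef_H₇_map`), because such a place is
  given by `ζ₇ ↦ ζ₇ᵏ` with `2 ≤ k ≤ 5` (`exists_apply_zeta7E_eq_pow`, `eq_subtype_of_apply_zeta7E`,
  `eq_conjugate_of_apply_zeta7E`) and `2cos(2πk/7) < 0` there (`cos_neg_of_two_le`); hence
  anisotropic (`H₇_anisotropic`, through the tree's `UnitaryGroup.anisotropic_of_posDef_map`);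
* `Γ₇ = Γ(3)`, the principal congruence subgroup of level `3` of `U(H₇)(E₇)` (`Γ₇`): a congruence
  subgroup by definition (`Γ₇_isCongruenceSubgroup`) and torsion-free by Minkowski (tree
  `torsionFree_principalCongruenceSubgroup`; `Γ₇_torsionFree`).

Consequences recorded: the adelic quotient `U(H₇)(F)\U(H₇)(𝔸_F)`, `F = E₇⁺ = ℚ(cos(2π/7))`, is
compact (`compactSpace_unitaryQuotient_H₇`, the tree's `PicardCM.compactUnitaryQuotient_holds`);
all hypotheses of `PicardCM.BallQuotientAlgebraic` hold for `(E₇, H₇, Γ₇)`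
(`picardSextic_hypotheses`, `exists_sextic_ballQuotient_input`), so that under that hypothesis the
surface `Γ₇\𝔹²` is realised as a `UnitaryBallQuotientDatum 2 X`
(`exists_unitaryBallQuotientDatum_of_ballQuotientAlgebraic` — the hypothesis is an argument, never
asserted).

Everything here is proved; no published theorem is invoked as a hypothesis. The data `E₇`, `H₇`,
`Γ₇`, `T₇` are closed terms (no `Classical.choice` on an existential).

## References

* N. Bergeron, J. Millson, C. Moeglin, *The Hodge conjecture and arithmetic quotients of complex
  balls*, Acta Math. 216 (2016), Introduction §1.1 (the groups `Γ = G(ℚ) ∩ K`, `E` a CM field,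
  `V` hermitian of signature `(p,1)` at one place and definite at the others).
  [BergeronMillsonMoeglin2016Balls]
* H. Minkowski, *Zur Theorie der positiven quadratischen Formen*, J. reine angew. Math. 101
  (1887), §1 (torsion-freeness of level `≥ 3`; tree theorem). [Minkowski1887]
* J. Getz, H. Hahn, *An Introduction to Automorphic Representations*, GTM 300 (2024), §2.6 p. 44
  (anisotropic ⇒ compact adelic quotient; tree theorem). [GetzHahn2024]
* L. C. Washington, *Introduction to Cyclotomic Fields*, 2nd ed., GTM 83 (1997), Ch. 2
  (`[ℚ(ζₙ):ℚ] = φ(n)`, `ℚ(ζₙ)` is CM with maximal real subfield `ℚ(ζₙ + ζₙ⁻¹)`; here re-proved from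
  Mathlib). [Washington1997]
-/

noncomputable section

open NumberField Module Complex IntermediateField
open scoped ComplexOrder
open Literature.AlgebraicGeometry.ShimuraVarieties
open Literature.AlgebraicGeometry.Motives (SchemeOver)
open scoped Matrix

namespace Literature.NumberTheory.Automorphic

namespace PicardSextic

/-! ### The field `E₇ = ℚ(ζ₇) ⊂ ℂ` -/

/-- `ζ₇ = exp(2πi/7) ∈ ℂ`. [folklore] -/
def zeta7 : ℂ := Complex.exp (2 * Real.pi * I / 7)

/-- `ζ₇` is a primitive seventh root of unity. [folklore] -/
theorem isPrimitiveRoot_zeta7 : IsPrimitiveRoot zeta7 7 := by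
  simpa [zeta7] using Complex.isPrimitiveRoot_exp 7 (by norm_num)

/-- `ζ₇⁷ = 1`. [folklore] -/
theorem zeta7_pow_seven : zeta7 ^ 7 = 1 := isPrimitiveRoot_zeta7.pow_eq_one

/-- `ζ₇ ≠ 0`. [folklore] -/
theorem zeta7_ne_zero : zeta7 ≠ 0 := isPrimitiveRoot_zeta7.ne_zero (by norm_num)

/-- `ζ₇ ≠ 1`. [folklore] -/
theorem zeta7_ne_one : zeta7 ≠ 1 := isPrimitiveRoot_zeta7.ne_one (by norm_num)

/-- `|ζ₇| = 1`. [folklore] -/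
theorem norm_zeta7 : ‖zeta7‖ = 1 := isPrimitiveRoot_zeta7.norm'_eq_one (by norm_num)

/-- `conj ζ₇ = ζ₇⁻¹`. [folklore] -/
theorem conj_zeta7 : starRingEnd ℂ zeta7 = zeta7⁻¹ := by
  have h : zeta7 * starRingEnd ℂ zeta7 = 1 := by
    rw [Complex.mul_conj, Complex.normSq_eq_norm_sq, norm_zeta7]
    norm_num
  exact (eq_inv_of_mul_eq_one_right h)

/-- `ζ₇ ^ k = exp(2πik/7)`. [folklore] -/
theorem zeta7_pow (k : ℕ) : zeta7 ^ k = Complex.exp ((2 * Real.pi * k / 7 : ℝ) * I) := by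
  rw [zeta7, ← Complex.exp_nat_mul]
  congr 1
  push_cast
  ring

/-- `exp(iθ) + exp(iθ)⁻¹ = 2 cos θ`. [folklore] -/
theorem exp_mul_I_add_inv (θ : ℝ) :
    Complex.exp (θ * I) + (Complex.exp (θ * I))⁻¹ = ((2 * Real.cos θ : ℝ) : ℂ) := by
  rw [← Complex.exp_neg, show -((θ : ℂ) * I) = ((-θ : ℝ) : ℂ) * I by push_cast; ring,
    Complex.exp_mul_I, Complex.exp_mul_I]
  push_cast
  rw [Complex.cos_neg, Complex.sin_neg]
  ring

/-- `ℚ(ζ₇) ⊂ ℂ` as an intermediate field of `ℂ/ℚ`. [folklore] -/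
def K₇ : IntermediateField ℚ ℂ := ℚ⟮zeta7⟯

/-- `ℚ(ζ₇)/ℚ` is the seventh cyclotomic extension. [folklore] -/
instance isCyclotomicExtension_K₇ : IsCyclotomicExtension {7} ℚ K₇ := by
  have halg : IsAlgebraic ℚ zeta7 :=
    ((isPrimitiveRoot_zeta7.isIntegral (by norm_num)).isAlgebraic).extendScalars
      (R := ℤ) (Int.cast_injective (α := ℚ))
  change IsCyclotomicExtension {7} ℚ (IntermediateField.adjoin ℚ {zeta7}).toSubalgebra
  rw [IntermediateField.adjoin_simple_toSubalgebra_of_isAlgebraic halg]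
  exact isPrimitiveRoot_zeta7.adjoin_isCyclotomicExtension ℚ

/-- `ℚ(ζ₇)` is a number field. [folklore] -/
instance numberField_K₇ : NumberField K₇ := IsCyclotomicExtension.numberField {7} ℚ K₇

/-- `ℚ(ζ₇)` is a CM field (a cyclotomic field with `n > 2`). [folklore] -/
instance isCMField_K₇ : IsCMField K₇ :=
  IsCyclotomicExtension.Rat.isCMField (K := K₇) (S := {7}) ⟨7, rfl, by norm_num⟩

/-- **`E₇ = ℚ(ζ₇) ⊂ ℂ`** as a subfield of `ℂ` (the type of the field `E` of the tree's
`UnitaryBallQuotientDatum`). [folklore] -/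
def E₇ : Subfield ℂ := K₇.toSubfield

/-- `E₇` is a number field. [folklore] -/
instance numberField_E₇ : NumberField E₇ := inferInstanceAs (NumberField K₇)

/-- `E₇` is a CM field (a non-trivial cyclotomic field). [folklore] -/
instance isCMField_E₇ : IsCMField E₇ := inferInstanceAs (IsCMField K₇)

/-- **`[E₇ : ℚ] = 6`** — the sextic regime. [folklore] -/
theorem finrank_E₇ : finrank ℚ E₇ = 6 := by
  have h := IsCyclotomicExtension.finrank (n := 7) (K := ℚ) K₇
    (Polynomial.cyclotomic.irreducible_rat (by norm_num))
  rw [Nat.totient_prime (by norm_num)] at h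
  exact h

/-- `[E₇ : ℚ] ≥ 4` (so `E₇` has at least two complex places). [folklore] -/
theorem four_le_finrank_E₇ : 4 ≤ finrank ℚ E₇ := by
  rw [finrank_E₇]; norm_num

/-- `E₇` is the subfield of `ℂ` generated by `ζ₇`. [folklore] -/
theorem E₇_eq_closure : E₇ = Subfield.closure (Set.range (algebraMap ℚ ℂ) ∪ {zeta7}) := rfl

/-- `ζ₇ ∈ E₇`. [folklore] -/
theorem zeta7_mem : zeta7 ∈ E₇ := IntermediateField.mem_adjoin_simple_self ℚ zeta7

/-- `ζ₇ ∈ E₇`. [folklore] -/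
def zeta7E : E₇ := ⟨zeta7, zeta7_mem⟩

/-- The underlying complex number of `zeta7E` is `ζ₇`. [folklore] -/
@[simp] theorem coe_zeta7E : ((zeta7E : E₇) : ℂ) = zeta7 := rfl

/-- `ζ₇⁷ = 1` in `E₇`. [folklore] -/
theorem zeta7E_pow_seven : zeta7E ^ 7 = 1 := Subtype.ext (by simpa using zeta7_pow_seven)

/-- `ζ₇ ≠ 0` in `E₇`. [folklore] -/
theorem zeta7E_ne_zero : zeta7E ≠ 0 := fun h => zeta7_ne_zero (congrArg Subtype.val h)

/-- **`c = ζ₇ + ζ₇⁻¹ = 2cos(2π/7) ∈ E₇⁺`**, the totally real element carrying the signs.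
[folklore] -/
def cSeven : E₇ := zeta7E + zeta7E⁻¹

/-- `ι(c) = ζ₇ + ζ₇⁻¹`. [folklore] -/
theorem coe_cSeven : ((cSeven : E₇) : ℂ) = zeta7 + zeta7⁻¹ := by
  simp [cSeven]

/-- `ι(c) = 2cos(2π/7)`. [folklore] -/
theorem coe_cSeven_eq_cos : ((cSeven : E₇) : ℂ) = ((2 * Real.cos (2 * Real.pi / 7) : ℝ) : ℂ) := by
  rw [coe_cSeven, ← exp_mul_I_add_inv, ← pow_one zeta7, zeta7_pow]
  norm_num

/-- `2cos(2π/7) > 0`. [folklore] -/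
theorem cos_two_pi_div_seven_pos : 0 < Real.cos (2 * Real.pi / 7) := by
  apply Real.cos_pos_of_mem_Ioo
  constructor <;> nlinarith [Real.pi_pos]

/-- `2cos(2πk/7) < 0` for `2 ≤ k ≤ 5`. [folklore] -/
theorem cos_neg_of_two_le {k : ℕ} (h2 : 2 ≤ k) (h5 : k ≤ 5) :
    Real.cos (2 * Real.pi * k / 7) < 0 := by
  have h2' : (2 : ℝ) ≤ k := by exact_mod_cast h2
  have h5' : (k : ℝ) ≤ 5 := by exact_mod_cast h5
  apply Real.cos_neg_of_pi_div_two_lt_of_lt <;> nlinarith [Real.pi_pos]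

/-- Complex conjugation of the CM field `E₇ ⊂ ℂ` fixes `c` (`c ∈ E₇⁺`). [folklore] -/
theorem conjRingHom_cSeven : conjRingHom E₇ cSeven = cSeven := by
  apply (E₇.subtype).injective
  rw [embedding_conjRingHom E₇ E₇.subtype cSeven]
  change starRingEnd ℂ ((cSeven : E₇) : ℂ) = ((cSeven : E₇) : ℂ)
  rw [coe_cSeven, map_add, map_inv₀, conj_zeta7, inv_inv, add_comm]

/-! ### The complex embeddings of `E₇` -/

/-- A ring homomorphism `E₇ → ℂ` is determined by its value on `ζ₇`. [folklore] -/
theorem ringHom_eq_of_apply_zeta7E (τ₁ τ₂ : E₇ →+* ℂ) (h : τ₁ zeta7E = τ₂ zeta7E) : τ₁ = τ₂ := by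
  have hle : E₇ ≤ (RingHom.eqLocusField τ₁ τ₂).map E₇.subtype := by
    refine E₇_eq_closure.le.trans (Subfield.closure_le.mpr ?_)
    rintro z (⟨q, rfl⟩ | hz)
    · refine ⟨(q : E₇), ?_, ?_⟩
      · change τ₁ (q : E₇) = τ₂ (q : E₇)
        rw [map_ratCast, map_ratCast]
      · change ((q : E₇) : ℂ) = algebraMap ℚ ℂ q
        rw [eq_ratCast]
        norm_cast
    · rw [Set.mem_singleton_iff] at hz
      subst hz
      exact ⟨zeta7E, h, rfl⟩
  refine RingHom.ext fun x => ?_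
  obtain ⟨y, hy, hyx⟩ := hle x.2
  have : y = x := Subtype.ext hyx
  subst this
  exact hy

/-- Every complex embedding of `E₇` sends `ζ₇` to `ζ₇ ^ k` for some `1 ≤ k ≤ 6`. [folklore] -/
theorem exists_apply_zeta7E_eq_pow (τ : E₇ →+* ℂ) :
    ∃ k : ℕ, 0 < k ∧ k < 7 ∧ τ zeta7E = zeta7 ^ k := by
  have h7 : (τ zeta7E) ^ 7 = 1 := by rw [← map_pow, zeta7E_pow_seven, map_one]
  obtain ⟨k, hk, hkeq⟩ := isPrimitiveRoot_zeta7.eq_pow_of_pow_eq_one h7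
  refine ⟨k, Nat.pos_of_ne_zero ?_, hk, hkeq.symm⟩
  rintro rfl
  rw [pow_zero] at hkeq
  have h1 : zeta7E = 1 := τ.injective (by rw [map_one]; exact hkeq.symm)
  exact zeta7_ne_one (by simpa using congrArg Subtype.val h1)

/-- The embedding with `ζ₇ ↦ ζ₇` is the inclusion. [folklore] -/
theorem eq_subtype_of_apply_zeta7E (τ : E₇ →+* ℂ) (h : τ zeta7E = zeta7) : τ = E₇.subtype :=
  ringHom_eq_of_apply_zeta7E τ E₇.subtype (by rw [h]; rfl)

/-- The embedding with `ζ₇ ↦ ζ₇⁻¹` is the complex conjugate of the inclusion. [folklore] -/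
theorem eq_conjugate_of_apply_zeta7E (τ : E₇ →+* ℂ) (h : τ zeta7E = zeta7⁻¹) :
    τ = ComplexEmbedding.conjugate E₇.subtype :=
  ringHom_eq_of_apply_zeta7E τ _ (by
    rw [h, ComplexEmbedding.conjugate_coe_eq]
    change zeta7⁻¹ = starRingEnd ℂ zeta7
    rw [conj_zeta7])

/-- `ζ₇⁶ = ζ₇⁻¹`. [folklore] -/
theorem zeta7_pow_six : zeta7 ^ 6 = zeta7⁻¹ :=
  eq_inv_of_mul_eq_one_left (by rw [← pow_succ, zeta7_pow_seven])

/-- The value of an embedding on `c`: `τ(c) = 2cos(2πk/7)` when `τ(ζ₇) = ζ₇ᵏ`. [folklore] -/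
theorem apply_cSeven_eq (τ : E₇ →+* ℂ) {k : ℕ} (hk : τ zeta7E = zeta7 ^ k) :
    τ cSeven = ((2 * Real.cos (2 * Real.pi * k / 7) : ℝ) : ℂ) := by
  rw [cSeven, map_add, map_inv₀, hk, zeta7_pow, exp_mul_I_add_inv]

/-- **At every complex place other than that of the inclusion, `-τ(c) > 0`**: such `τ` send
`ζ₇ ↦ ζ₇ᵏ` with `2 ≤ k ≤ 5`, where `2cos(2πk/7) < 0`. [folklore] -/
theorem neg_apply_cSeven_pos (τ : E₇ →+* ℂ)
    (hτ : InfinitePlace.mk τ ≠ InfinitePlace.mk E₇.subtype) : (0 : ℂ) < -τ cSeven := by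
  obtain ⟨k, hk0, hk7, hk⟩ := exists_apply_zeta7E_eq_pow τ
  have hk1 : k ≠ 1 := by
    rintro rfl
    rw [pow_one] at hk
    exact hτ (by rw [eq_subtype_of_apply_zeta7E τ hk])
  have hk6 : k ≠ 6 := by
    rintro rfl
    rw [zeta7_pow_six] at hk
    exact hτ (by rw [eq_conjugate_of_apply_zeta7E τ hk, InfinitePlace.mk_conjugate_eq])
  have h2 : 2 ≤ k := by omega
  have h5 : k ≤ 5 := by omega
  rw [apply_cSeven_eq τ hk, ← Complex.ofReal_neg]
  exact Complex.zero_lt_real.mpr (by linarith [cos_neg_of_two_le h2 h5])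

/-! ### The hermitian matrix `H₇ = diag(1, 1, -c)` -/

/-- The diagonal entries `(1, 1, -c)`. [folklore] -/
def d₇ (i : Fin 3) : E₇ := if i = Fin.last 2 then -cSeven else 1

/-- **`H₇ = diag(1, 1, -(ζ₇ + ζ₇⁻¹)) ∈ M₃(E₇)`**. [folklore] -/
def H₇ : Matrix (Fin 3) (Fin 3) E₇ := Matrix.diagonal d₇

/-- The diagonal entries of `H₇` lie in `E₇⁺`. [folklore] -/
theorem conjRingHom_d₇ (i : Fin 3) : conjRingHom E₇ (d₇ i) = d₇ i := by
  unfold d₇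
  split_ifs
  · rw [map_neg, conjRingHom_cSeven]
  · rw [map_one]

/-- `H₇` is hermitian for the CM conjugation of `E₇`. [folklore] -/
theorem H₇_hermitian : ∀ i j, conjRingHom E₇ (H₇ i j) = H₇ j i := by
  intro i j
  by_cases hij : i = j
  · subst hij
    rw [H₇, Matrix.diagonal_apply_eq, conjRingHom_d₇]
  · rw [H₇, Matrix.diagonal_apply_ne _ hij, Matrix.diagonal_apply_ne _ (Ne.symm hij), map_zero]

/-- **`H₇` is positive definite at every complex place other than that of the inclusion.**
[folklore] -/
theorem posDef_H₇_map (τ : E₇ →+* ℂ) (hτ : InfinitePlace.mk τ ≠ InfinitePlace.mk E₇.subtype) :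
    (H₇.map τ).PosDef := by
  rw [H₇, Matrix.diagonal_map (map_zero τ), Matrix.posDef_diagonal_iff]
  intro i
  unfold d₇
  split_ifs
  · rw [map_neg]
    exact neg_apply_cSeven_pos τ hτ
  · rw [map_one]
    exact zero_lt_one

/-- There is a complex place of `E₇` other than that of the inclusion. [folklore] -/
theorem exists_mk_ne_mk_subtype :
    ∃ τ : E₇ →+* ℂ, InfinitePlace.mk τ ≠ InfinitePlace.mk E₇.subtype :=
  UnitaryGroup.exists_infinitePlace_ne E₇ four_le_finrank_E₇ E₇.subtype

/-- **`H₇` is anisotropic** (it is definite at a second place). [folklore] -/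
theorem H₇_anisotropic : ∀ v : Fin 3 → E₇, hermForm (conjRingHom E₇) H₇ v v = 0 → v = 0 := by
  obtain ⟨τ, hτ⟩ := exists_mk_ne_mk_subtype
  exact UnitaryGroup.anisotropic_of_posDef_map E₇ H₇ τ (posDef_H₇_map τ hτ)

/-! ### Signature `(2, 1)` at the inclusion -/

/-- The positive real number `c₁ = 2cos(2π/7) = ι(c)`. [folklore] -/
def cOne : ℝ := 2 * Real.cos (2 * Real.pi / 7)

/-- `2cos(2π/7) > 0`. [folklore] -/
theorem cOne_pos : 0 < cOne := by
  have := cos_two_pi_div_seven_pos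
  unfold cOne
  positivity

/-- `ι(c) = c₁`. [folklore] -/
theorem coe_cSeven_eq_cOne : ((cSeven : E₇) : ℂ) = (cOne : ℂ) := coe_cSeven_eq_cos

/-- The diagonal change of basis `t = (1, 1, 1/√c₁)`. [folklore] -/
def t₇ (i : Fin 3) : ℂ := if i = Fin.last 2 then (((Real.sqrt cOne)⁻¹ : ℝ) : ℂ) else 1

/-- `√c₁ ≠ 0`. [folklore] -/
theorem sqrt_cOne_ne_zero : Real.sqrt cOne ≠ 0 := (Real.sqrt_pos.mpr cOne_pos).ne'

/-- The entries of `t` are non-zero. [folklore] -/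
theorem t₇_ne_zero (i : Fin 3) : t₇ i ≠ 0 := by
  unfold t₇
  split_ifs
  · exact_mod_cast inv_ne_zero sqrt_cOne_ne_zero
  · exact one_ne_zero

/-- The entries of `t` are real. [folklore] -/
theorem star_t₇ (i : Fin 3) : star (t₇ i) = t₇ i := by
  unfold t₇
  split_ifs
  · exact Complex.conj_ofReal _
  · exact star_one ℂ

/-- `det diag(t) ≠ 0`. [folklore] -/
theorem det_diagonal_t₇_ne_zero : (Matrix.diagonal t₇).det ≠ 0 := by
  rw [Matrix.det_diagonal]
  exact Finset.prod_ne_zero_iff.mpr fun i _ => t₇_ne_zero i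

/-- `T = diag(1, 1, 1/√c₁) ∈ GL₃(ℂ)`. [folklore] -/
def T₇ : GL (Fin 3) ℂ :=
  Matrix.GeneralLinearGroup.mkOfDetNeZero (Matrix.diagonal t₇) det_diagonal_t₇_ne_zero

/-- The matrix of `T₇` is `diag(t)`. [folklore] -/
@[simp] theorem coe_T₇ : (T₇ : Matrix (Fin 3) (Fin 3) ℂ) = Matrix.diagonal t₇ := rfl

/-- `(1/√c₁) · c₁ · (1/√c₁) = 1`. [folklore] -/
theorem sqrt_inv_mul_cOne_mul_sqrt_inv : (Real.sqrt cOne)⁻¹ * cOne * (Real.sqrt cOne)⁻¹ = 1 := by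
  rw [mul_comm, ← mul_assoc, ← mul_inv, Real.mul_self_sqrt cOne_pos.le,
    inv_mul_cancel₀ cOne_pos.ne']

/-- **Signature `(2,1)` at the inclusion**: `Tᴴ · ι(H₇) · T = diag(1, 1, -1)`. [folklore] -/
theorem H₇_signature :
    ∃ T : GL (Fin 3) ℂ,
      (T : Matrix (Fin 3) (Fin 3) ℂ)ᴴ * H₇.map E₇.subtype * (T : Matrix (Fin 3) (Fin 3) ℂ) =
        signatureMatrix 2 := by
  refine ⟨T₇, ?_⟩
  rw [coe_T₇, Matrix.diagonal_conjTranspose, H₇, Matrix.diagonal_map (map_zero _),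
    Matrix.diagonal_mul_diagonal, Matrix.diagonal_mul_diagonal, signatureMatrix]
  congr 1
  funext i
  rw [Pi.star_apply, star_t₇]
  unfold t₇ d₇
  split_ifs
  · rw [map_neg, Subfield.coe_subtype, coe_cSeven_eq_cOne, mul_neg, neg_mul, neg_inj]
    exact_mod_cast sqrt_inv_mul_cOne_mul_sqrt_inv
  · rw [map_one, mul_one, mul_one]

/-! ### The congruence subgroup `Γ₇ = Γ(3)` -/

/-- **`Γ₇ = Γ(3) ≤ U(H₇)(E₇)`**, the principal congruence subgroup of level `3`.
[cite: BergeronMillsonMoeglin2016Balls, Introduction §1.1] -/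
def Γ₇ : Subgroup (GL (Fin 3) E₇) := principalCongruenceSubgroup (conjRingHom E₇) H₇ 3

/-- `Γ₇` is a congruence subgroup. [folklore] -/
theorem Γ₇_isCongruenceSubgroup : IsCongruenceSubgroup (conjRingHom E₇) H₇ Γ₇ := by
  refine ⟨fun g hg => ?_, 3, by norm_num, le_rfl, ?_⟩
  · obtain ⟨h, -, -⟩ := hg
    exact h
  · rw [Γ₇, Subgroup.subgroupOf_self]
    infer_instance

/-- `Γ₇` is torsion-free (Minkowski; tree `torsionFree_principalCongruenceSubgroup`).
[cite: Minkowski1887, §1] -/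
theorem Γ₇_torsionFree : ∀ γ ∈ Γ₇, IsOfFinOrder γ → γ = 1 :=
  torsionFree_principalCongruenceSubgroup (conjRingHom E₇) H₇ (le_refl 3)

/-! ### Compactness and the capstones -/

/-- **`[U(H₇)] = U(F)\\U(𝔸_F)` is compact** — the tree's kernel Godement criterion
(`Godement.compactSpace_adelicUnitaryQuot`, through `PicardCM.compactUnitaryQuotient_holds`) applied
to the anisotropic `H₇`. [folklore] -/
theorem compactSpace_unitaryQuotient_H₇ :
    CompactSpace (adelicUnitaryGroup E₇ H₇ ⧸ adelicUnitaryRat E₇ H₇) :=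
  PicardCM.compactUnitaryQuotient_holds E₇ 3 H₇ H₇_hermitian H₇_anisotropic

/-- **The explicit sextic Picard datum satisfies every hypothesis of
`PicardCM.BallQuotientAlgebraic`** (and its unitary quotient is compact): `[E₇ : ℚ] = 6`, `H₇`
hermitian, anisotropic, of signature `(2,1)` at the inclusion and positive definite at every other
place, `Γ₇` a torsion-free congruence subgroup. [folklore] -/
theorem picardSextic_hypotheses :
    finrank ℚ E₇ = 6 ∧
    (∀ i j, conjRingHom E₇ (H₇ i j) = H₇ j i) ∧
    (∀ v : Fin 3 → E₇, hermForm (conjRingHom E₇) H₇ v v = 0 → v = 0) ∧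
    (∃ T : GL (Fin 3) ℂ,
      (T : Matrix (Fin 3) (Fin 3) ℂ)ᴴ * H₇.map E₇.subtype * (T : Matrix (Fin 3) (Fin 3) ℂ) =
        signatureMatrix 2) ∧
    (∀ τ : E₇ →+* ℂ, InfinitePlace.mk τ ≠ InfinitePlace.mk E₇.subtype → (H₇.map τ).PosDef) ∧
    IsCongruenceSubgroup (conjRingHom E₇) H₇ Γ₇ ∧
    (∀ γ ∈ Γ₇, IsOfFinOrder γ → γ = 1) ∧
    CompactSpace (adelicUnitaryGroup E₇ H₇ ⧸ adelicUnitaryRat E₇ H₇) :=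
  ⟨finrank_E₇, H₇_hermitian, H₇_anisotropic, H₇_signature, posDef_H₇_map, Γ₇_isCongruenceSubgroup,
    Γ₇_torsionFree, compactSpace_unitaryQuotient_H₇⟩

/-- **Under hypothesis (ii) `PicardCM.BallQuotientAlgebraic`, the sextic Picard modular surface
`Γ₇ \ 𝔹²` exists as a `UnitaryBallQuotientDatum 2 X`** — the hypothesis applied to the explicit
datum `(E₇, H₇, Γ₇)`; this certifies that the datum has exactly the types the hypothesis consumes.
[folklore] -/
theorem exists_unitaryBallQuotientDatum_of_ballQuotientAlgebraic
    (h : PicardCM.BallQuotientAlgebraic) :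
    ∃ (X : SchemeOver ℂ) (D : UnitaryBallQuotientDatum 2 X),
      D.E = E₇ ∧ D.H.map D.E.subtype = H₇.map E₇.subtype ∧
        D.Γ.map (Matrix.GeneralLinearGroup.map (D.E.subtype : D.E →+* ℂ)) =
          Γ₇.map (Matrix.GeneralLinearGroup.map (E₇.subtype : E₇ →+* ℂ)) :=
  h E₇ H₇ Γ₇ H₇_hermitian H₇_anisotropic H₇_signature posDef_H₇_map Γ₇_isCongruenceSubgroup
    Γ₇_torsionFree

/-- **A sextic input for (ii) exists** (existential form over the binder types of
`PicardCM.BallQuotientAlgebraic`). [folklore] -/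
theorem exists_sextic_ballQuotient_input :
    ∃ (E : Subfield ℂ) (_ : NumberField E) (_ : IsCMField E) (H : Matrix (Fin 3) (Fin 3) E)
      (Γ : Subgroup (GL (Fin 3) E)),
      finrank ℚ E = 6 ∧
      (∀ i j, conjRingHom E (H i j) = H j i) ∧
      (∀ v : Fin 3 → E, hermForm (conjRingHom E) H v v = 0 → v = 0) ∧
      (∃ T : GL (Fin 3) ℂ,
        (T : Matrix (Fin 3) (Fin 3) ℂ)ᴴ * H.map E.subtype * (T : Matrix (Fin 3) (Fin 3) ℂ) =
          signatureMatrix 2) ∧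
      (∀ τ : E →+* ℂ, InfinitePlace.mk τ ≠ InfinitePlace.mk E.subtype → (H.map τ).PosDef) ∧
      IsCongruenceSubgroup (conjRingHom E) H Γ ∧
      (∀ γ ∈ Γ, IsOfFinOrder γ → γ = 1) :=
  ⟨E₇, inferInstance, inferInstance, H₇, Γ₇, finrank_E₇, H₇_hermitian, H₇_anisotropic,
    H₇_signature, posDef_H₇_map, Γ₇_isCongruenceSubgroup, Γ₇_torsionFree⟩

end PicardSextic

end Literature.NumberTheory.Automorphic
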